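import Literature.NumberTheory.Automorphic.ResGL2TorusExponents
import Literature.NumberTheory.Automorphic.TorusEigensystemGrossencharakter
import Literature.NumberTheory.Automorphic.ResGL2EisensteinHalfReduction
import HarnessLib

/-!
# The `t^B_2`-eigensystem on the Borel strata of `Res_{F/ℚ} GL₂` (`F` totally real) is a Größencharakter

Topic `NumberTheory/Automorphic`; namespace `Literature.NumberTheory.Automorphic.ResGLnCohomology`.
Theorems only; the totally real version of `TorusEigensystemGrossencharakter` (imaginary quadratic)
and the discharge of hypothesis **(T)** of `ResGL2EisensteinHalfReduction`.

For `F` totally real, `𝔫 ≠ 0` and `y₀ ≠ 0` in the Borel model of the stratum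
`H^q(B(F)⁺, Fun(GL₂(𝔸_F^∞)/K_f(𝔫), E_λ))` with `T^B_{e₂,w} y₀ = μ_w y₀`, `μ_w ≠ 0` (`w ∤ 𝔫`), the
function `w ↦ ι (μ_w)` is an algebraic Größencharakter
(`isGrossencharakter_torusEigensystem_borelPos`): by `ResGL2TorusExponents`,
`∏_{w ∣ x} μ_w^{ord_w x} = ∏_τ τ(x)^{e_τ}` for the totally positive `x ≡ 1 mod 𝔫`; for `b ≡ c mod 𝔣`
with `b/c` totally positive the elements `c^{2h}` and `b c^{2h−1}` (`c^h ≡ 1 mod 𝔫`) are such, whence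
the infinity type `(p_w, 0) = (e_{σ_w}, 0)` on the ray [Harder1987, §2, (2.7)–(2.8)].  Consequently
(`Harder1987_eigensystem_cuspidalOrEisenstein_of_interior`) **the fact
`Harder1987_eigensystem_cuspidalOrEisenstein` is reduced to its interior half (I)** (the description of
the interior eigenclasses by cuspidal automorphic representations, [Harder1987, §3]).

## References

* G. Harder, *Eisenstein cohomology of arithmetic groups. The case GL₂*, Invent. Math. 89 (1987), §2.
  [Harder1987]
* J. Neukirch, *Algebraic Number Theory* (1999), Ch. VII §6. [NeukirchANT1999]
-/

noncomputable section

open scoped NumberField ComplexConjugate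
open IsDedekindDomain NumberField

namespace Literature.NumberTheory.Automorphic

namespace ResGLnCohomology

open BigHeckeGLn ParallelWeight Literature.NumberTheory.GaloisRepresentations

variable {F : Type} [Field F] [NumberField F]

/-- `Ω(b)/Ω(c) = ∏_w w(b/c)^{e(σ_w)} · \overline{w(b/c)}^0` in a totally real field. [folklore] -/
theorem algChar_div_eq_prod_infinitePlace_real (hF : IsTotallyReal F) (e : (F →+* ℂ) → ℤ) (b c : F) :
    algChar e b / algChar e c =
      ∏ w : InfinitePlace F, w.embedding (b / c) ^ e w.embedding * conj (w.embedding (b / c)) ^ (0 : ℤ) := by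
  have hdiv : algChar e b / algChar e c = ∏ σ : F →+* ℂ, σ (b / c) ^ e σ := by
    rw [algChar, algChar, ← Finset.prod_div_distrib]
    exact Finset.prod_congr rfl fun σ _ => by rw [map_div₀, div_zpow]
  rw [hdiv, prod_embeddings_eq_prod_infinitePlace]
  refine Finset.prod_congr rfl fun w _ => ?_
  haveI := hF
  rw [InfinitePlace.mult, if_pos (IsTotallyReal.isReal w), Nat.sub_self, pow_zero, zpow_zero]

/-! ### The main theorem -/

section Main

variable {E : Type} [Field E] [CharZero E] [IsAlgClosed E]

/-- **The `t^B_2`-eigensystem on the Borel strata of `Res_{F/ℚ} GL₂` is an algebraic Größencharakter**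
(`F` totally real).  See the module docstring. [cite: Harder1987, §2, (2.7)–(2.8)] -/
theorem isGrossencharakter_torusEigensystem_borelPos (hF : IsTotallyReal F) (ι : E ≃+* ℂ) {𝔫 : Ideal (𝓞 F)}
    (h𝔫 : 𝔫 ≠ 0) (lam : (F →+* E) → Fin 2 → ℤ) (q : ℕ) {y₀ : borelPosModelCohomology E F 𝔫 lam q} (hy₀ : y₀ ≠ 0)
    (μ : HeightOneSpectrum (𝓞 F) → E)
    (hμ : ∀ w : HeightOneSpectrum (𝓞 F), ¬ w.asIdeal ∣ 𝔫 →
      borelPosModelHecke E F 𝔫 lam q (borelHeckeElement₂ _ w) y₀ = μ w • y₀ ∧ μ w ≠ 0) :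
    ∃ (𝔣 : Ideal (𝓞 F)) (p q' : InfinitePlace F → ℤ), 𝔣 ≠ ⊥ ∧ IsGrossencharakter 𝔣 p q' (fun w => ι (μ w)) := by
  classical
  obtain ⟨e, he⟩ := exists_torus_exponents_borelPos lam h𝔫 q hy₀ μ fun w hw => (hμ w hw).1
  have hS : ({v : HeightOneSpectrum (𝓞 F) | v.asIdeal ∣ 𝔫} : Set _).Finite := Ideal.finite_factors h𝔫
  have h𝔫' : 𝔫 ≠ ⊥ := h𝔫
  -- transport the exponents along `ι`
  let e' : (F →+* ℂ) → ℤ := fun σ => e ((embEquiv ι).symm σ)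
  -- `idealPow (ι ∘ μ) (x) = Ω(x)` on the totally positive admissible `x`
  have hadm : ∀ (x : 𝓞 F) (hx : x ≠ 0), x - 1 ∈ 𝔫 → (∀ τ : F →+* ℝ, 0 < τ (x : F)) →
      LFunctions.idealPow F (fun w => ι (μ w)) (Ideal.span {x}) = algChar e' (x : F) := by
    intro x hx hx1 hxpos
    rw [← map_listProd_eq_idealPow E ι μ x hx, he x hx hx1 hxpos, map_prod, algChar]
    refine Fintype.prod_equiv (embEquiv ι) _ _ fun τ => ?_
    have hτ : (embEquiv (F := F) ι τ) (x : F) = ι (τ x) := rfl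
    rw [hτ, map_zpow₀]
    simp only [e', Equiv.symm_apply_apply]
  -- non-vanishing of `idealPow` away from `𝔫`
  have hP0 : ∀ (x : 𝓞 F) (hx : x ≠ 0), (∀ w : HeightOneSpectrum (𝓞 F), w.asIdeal ∣ Ideal.span {x} → ¬ w.asIdeal ∣ 𝔫) →
      LFunctions.idealPow F (fun w => ι (μ w)) (Ideal.span {x}) ≠ 0 := by
    intro x hx hxS
    rw [← map_listProd_eq_idealPow E ι μ x hx, map_ne_zero]
    refine List.prod_ne_zero fun h0 => ?_
    obtain ⟨w, hw, hw0⟩ := List.mem_map.1 h0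
    exact pow_ne_zero _ (hμ w (hxS w ((mem_suppOf hx).1 (Finset.mem_toList.1 hw)))).2 hw0
  refine ⟨conductorOf 𝔫 hS, fun w => e' w.embedding, fun _ => 0, conductorOf_ne_bot h𝔫 hS, fun v hv => ?_,
    fun b c hb hc hcop hbc hpos => ?_⟩
  · rw [map_ne_zero]
    exact (hμ v (not_mem_and_not_dvd_of_not_le hS hv).2).2
  · -- the prime factors of `b` and `c` avoid `𝔫`
    have hcS : ∀ w : HeightOneSpectrum (𝓞 F), w.asIdeal ∣ Ideal.span {c} → ¬ w.asIdeal ∣ 𝔫 :=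
      fun w hw => (not_mem_and_not_dvd_of_not_le hS (not_le_of_dvd_span_of_isCoprime hcop hw)).2
    have hbc' : b - c ∈ 𝔫 := Ideal.mul_le_right hbc
    -- `c^h ≡ 1 mod 𝔫`, `k = 2h`
    have hcop𝔫 : IsCoprime (Ideal.span {c}) 𝔫 :=
      hcop.of_isCoprime_of_dvd_right (dvd_mul_right 𝔫 _)
    obtain ⟨h, hpos', hch⟩ := exists_pow_sub_one_mem h𝔫' hcop𝔫
    set k := 2 * h with hk
    have hkpos : 0 < k := by omega
    have hck : c ^ k - 1 ∈ 𝔫 := by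
      have : c ^ k - 1 = (c ^ h - 1) * (c ^ h + 1) := by rw [hk]; ring
      rw [this]
      exact Ideal.mul_mem_right _ _ hch
    -- the totally positive admissible elements `x₁ = c^k`, `x₂ = b c^{k-1}`
    have hx₁ : c ^ k ≠ 0 := pow_ne_zero _ hc
    have hx₂ : b * c ^ (k - 1) ≠ 0 := mul_ne_zero hb (pow_ne_zero _ hc)
    have hcR : ∀ τ : F →+* ℝ, τ (c : F) ≠ 0 := fun τ => (map_ne_zero τ).2 (by exact_mod_cast hc)
    have hx₁pos : ∀ τ : F →+* ℝ, 0 < τ (((c ^ k : 𝓞 F)) : F) := by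
      intro τ
      rw [show (((c ^ k : 𝓞 F)) : F) = (c : F) ^ k by push_cast; rfl, map_pow, hk]
      exact Even.pow_pos (even_two_mul h) (hcR τ)
    have hx₂pos : ∀ τ : F →+* ℝ, 0 < τ (((b * c ^ (k - 1) : 𝓞 F)) : F) := by
      intro τ
      rw [show (((b * c ^ (k - 1) : 𝓞 F)) : F) = (b : F) * (c : F) ^ (k - 1) by push_cast; rfl, map_mul, map_pow,
        show k - 1 = 2 * (h - 1) + 1 by omega, pow_succ, ← mul_assoc, mul_comm (τ (b : F))]
      rw [mul_assoc]
      exact mul_pos (Even.pow_pos (even_two_mul _) (hcR τ)) (by simpa only [mul_comm] using hpos τ)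
    have hx₂1 : b * c ^ (k - 1) - 1 ∈ 𝔫 := by
      have hsplit : b * c ^ (k - 1) - 1 = (b - c) * c ^ (k - 1) + (c ^ k - 1) := by
        have : c ^ k = c * c ^ (k - 1) := by
          rw [← pow_succ']; congr 1; omega
        rw [this]; ring
      rw [hsplit]
      exact add_mem (Ideal.mul_mem_right _ _ hbc') hck
    have E1 := hadm (c ^ k) hx₁ hck hx₁pos
    have E2 := hadm (b * c ^ (k - 1)) hx₂ hx₂1 hx₂pos
    -- `idealPow` and `Ω` are multiplicative
    have hspan_c : Ideal.span {c} ≠ ⊥ := by rwa [Ne, Ideal.span_singleton_eq_bot]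
    have hspan_b : Ideal.span {b} ≠ ⊥ := by rwa [Ne, Ideal.span_singleton_eq_bot]
    have hcF : (c : F) ≠ 0 := by exact_mod_cast hc
    have hcoe₁ : ((c ^ k : 𝓞 F) : F) = (c : F) ^ k := by push_cast; rfl
    have hcoe₂ : ((b * c ^ (k - 1) : 𝓞 F) : F) = (b : F) * (c : F) ^ (k - 1) := by push_cast; rfl
    rw [← Ideal.span_singleton_pow, LFunctions.idealPow_pow _ hspan_c, hcoe₁, algChar_pow] at E1
    rw [← Ideal.span_singleton_mul_span_singleton, ← Ideal.span_singleton_pow,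
      LFunctions.idealPow_mul _ hspan_b (pow_ne_zero _ hspan_c), LFunctions.idealPow_pow _ hspan_c, hcoe₂,
      algChar_mul, algChar_pow] at E2
    set P := LFunctions.idealPow F (fun w => ι (μ w)) (Ideal.span {c}) with hP
    set Q := LFunctions.idealPow F (fun w => ι (μ w)) (Ideal.span {b}) with hQ
    set W := algChar e' (c : F) with hW
    set V := algChar e' (b : F) with hV
    have hW0 : W ≠ 0 := algChar_ne_zero e' hcF
    have hPk : P ^ k = P ^ (k - 1) * P := by
      rw [← pow_succ]; congr 1; omega
    have hWk : W ^ k = W ^ (k - 1) * W := by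
      rw [← pow_succ]; congr 1; omega
    have key : Q * W * W ^ k = P * V * W ^ k := by
      calc Q * W * W ^ k = Q * W * P ^ k := by rw [E1]
        _ = Q * P ^ (k - 1) * P * W := by rw [hPk]; ring
        _ = V * W ^ (k - 1) * P * W := by rw [E2]
        _ = P * V * (W ^ (k - 1) * W) := by ring
        _ = P * V * W ^ k := by rw [← hWk]
    have key' : Q * W = P * V := mul_right_cancel₀ (pow_ne_zero k hW0) key
    show Q = P * ∏ w : InfinitePlace F, w.embedding ((b : F) / c) ^ e' w.embedding *
      conj (w.embedding ((b : F) / c)) ^ (0 : ℤ)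
    rw [← algChar_div_eq_prod_infinitePlace_real hF e' (b : F) (c : F), mul_div_assoc', eq_div_iff hW0, key']

end Main

/-! ### The fact, reduced to its interior half -/

/-- **`Harder1987_eigensystem_cuspidalOrEisenstein` from its interior half (I).**  The Eisenstein
half is now unconditional: `ResGL2EisensteinHalfReduction` with hypothesis (T) discharged by
`isGrossencharakter_torusEigensystem_borelPos`. [cite: Harder1987, §1, §2, §4.2 Thm. 2] -/
theorem Harder1987_eigensystem_cuspidalOrEisenstein_of_interior
    (hI : ∀ (F : Type) [Field F] [NumberField F], NumberField.IsTotallyReal F →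
      ∀ (hcpt : isCompact_glFiniteIntegralLevel 2 F) (E : Type) [Field E] (ι : E ≃+* ℂ)
        (𝔫 : Ideal (𝓞 F)), 𝔫 ≠ 0 →
      ∀ (lam : (F →+* E) → Fin 2 → ℤ) (q : ℕ) (c : levelCohomology E 2 F 𝔫 lam q),
        c ∈ interiorLevelCohomology E 2 F 𝔫 lam q → c ≠ 0 →
      ∀ (a : HeightOneSpectrum (𝓞 F) → ℕ → E),
        (∀ᶠ w in Filter.cofinite, heckeT E 2 F 𝔫 lam q w 1 c = a w 1 • c ∧
          heckeT E 2 F 𝔫 lam q w 2 c = a w 2 • c) →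
        (∃ π₀ : CuspidalAutomorphicRepData 2 F hcpt, π₀.1.IsRegularAlgebraic ∧
          ∀ᶠ w in Filter.cofinite, ∃ α : Multiset ℂ, π₀.1.HasSatakeParamAt w α ∧
            ι (a w 1) = ((Real.sqrt (w.residueCard : ℝ) : ℝ) : ℂ) * α.esymm 1 ∧
              ι (a w 2) = α.esymm 2) ∨
        (∃ (𝔣 : Ideal (𝓞 F)) (p₁ q₁ p₂ q₂ : InfinitePlace F → ℤ)
            (ψ₁ ψ₂ : HeightOneSpectrum (𝓞 F) → ℂ),
          𝔣 ≠ ⊥ ∧ IsGrossencharakter 𝔣 p₁ q₁ ψ₁ ∧ IsGrossencharakter 𝔣 p₂ q₂ ψ₂ ∧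
          ∀ᶠ w in Filter.cofinite, ι (a w 1) = ψ₁ w + ψ₂ w ∧
            ((Ideal.absNorm w.asIdeal : ℕ) : ℂ) * ι (a w 2) = ψ₁ w * ψ₂ w)) :
    Harder1987_eigensystem_cuspidalOrEisenstein :=
  Harder1987_eigensystem_cuspidalOrEisenstein_of_interior_of_torusChar hI
    fun _ _ _ hF _ _ _ _ ι _ h𝔫 lam q _ μ hy₀ hμ =>
      isGrossencharakter_torusEigensystem_borelPos hF ι h𝔫 lam q hy₀ μ hμ

end ResGLnCohomology

end Literature.NumberTheory.Automorphic

end
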